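import Summits.ResolutionOfSingularities.ResolutionOfSingularities.Theorems.WildQuotientsSummitReductionStubPairOrbitBlowupCentreLocalLemmas6
import Summits.ResolutionOfSingularities.ResolutionOfSingularities.Theorems.WildQuotientsSummitReductionStubPairOrbitBlowupCentreLocalLemmas7
import Summits.ResolutionOfSingularities.ResolutionOfSingularities.Theorems.WildQuotientsSummitReductionStubPairOrbitBlowupCentreLocalLemmas16
import Summits.ResolutionOfSingularities.ResolutionOfSingularities.Theorems.WildQuotientsSummitReductionStubPairOrbitBlowupCentreLocalLemmas19
import Summits.ResolutionOfSingularities.ResolutionOfSingularities.Theorems.WildQuotientsSummitReductionStubPairOrbitBlowupCentreFlat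
import Literature.AlgebraicGeometry.Resolution.SmoothLocusBaseChange
import Mathlib.AlgebraicGeometry.Noetherian
import HarnessLib

/-!
# `WildQuotients.SummitReduction` (stmt-ResolutionOfSingularities-16324), line `FramePerfect`:
# stub `stub_pair_orbitBlowupCentreLocal` — (H4) ∧ (H2) of de Jong 1996, 3.4 Claim (ii) over the
# orbit centre, for ANY blow-up of a quasi-split `G`-semi-stable pair in the reduced orbit closure

Route `ResolutionOfSingularities/WildQuotients`, crux `SummitReduction`
(`Summit.ResolutionOfSingularities.ResolutionOfSingularities.Theses.WildQuotients.SummitReduction`),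
line `FramePerfect`, stub C2 of the skeleton. For a `G`-semi-stable pair `(Y, D)`, `f : X → Y` with
the quasi-split rendering of de Jong 1997, 5.7 (`hqs`), a codimension-`2` singular point `x` and
ANY blowing up `π : X₁ → X` in the reduced ideal of the orbit closure `Z = cl(G · x)`, the theorem
`stub_pair_orbitBlowupCentreLocal` PROVES:

* (H4) `π ≫ f` is quasi-split at its non-smooth points over `Z`: the completed fibre local ring is
  `κ(y)⟦u, v⟧/(uv)` compatibly with `κ(y)` ("the singular points of the fibres of `X' → Y` in `E`
  are rational with rational tangents", de Jong 1997, p. 618);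
* (H2) the closed points over `Z` of the geometric fibres `X₁ ×_Y Spec K` of `π ≫ f` are regular of
  dimension `1` or ordinary double points (de Jong 1996, 3.4 Claim (ii): "This scheme is smooth
  over `k`, except at the maximal ideal `(u, t₁')`", p. 64).

Proof. File 6 (`orbitCentreLocal_exists_chart_and_quasiSplitDatum`: completion commutes with blowing
up) gives at every point `x'` of `X₁` over `Z` Cohen coordinates `Λ` of the base, a chart
`Λ[x, y]/(xy - a_j)` of the blow-up of the formal model, a prime `𝔔 ⊇ 𝔪_Λ` and
`𝒪̂_{X₁,x'} ≅ (chart)_𝔔^` compatibly with the base, together with the quasi-split datum when `𝔔` is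
the origin `x̄, ȳ ∈ 𝔔`. Off the origin, `π ≫ f` is SMOOTH at `x'` (file 16: flatness over `Z` from
stub C1, `stub_pair_orbitBlowupCentreFlat`, the fibre criterion with flatness at the point and
descent from finite purely inseparable extensions of `κ(y)`, files 13–15, the regularity input
being the geometric chart comparison: the engine of file 9 with the level data of file 12 and the
models of file 10), which settles (H4). For (H2) at a closed point `x̄'` over `x'`: at an origin the
datum of (H4) makes `x̄'` an ordinary double point (file 7); off the origin `𝒪_{X₁ ×_Y Spec K, x̄'}` is
regular of dimension `1` (file 19: the local ring of the base change at the rational point `x̄'` is a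
localization of `K ⊗_{κ(y)} B`, file 17, compared by the engine with a local ring of
`K[x, y]/(xy - ā)` at a `K`-point off the origin, files 18, 10).
-/

set_option linter.dupNamespace false

noncomputable section

open CategoryTheory CategoryTheory.Limits AlgebraicGeometry TopologicalSpace
open Literature.AlgebraicGeometry.Resolution
open Literature.AlgebraicGeometry
open Literature.AlgebraicGeometry.Resolution.DeJong1996
open IsLocalRing Scheme.IdealSheafData NodalDeformation DeJong1996.AlgebraicNodeRing

namespace Summit.ResolutionOfSingularities.ResolutionOfSingularities.Theorems

-- the definitional unification of the stalk forms `f (π x')`/`(π ≫ f) x'` is slow (kabstract on stalks)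
set_option maxHeartbeats 6400000 in
/-- **Stub C2 of line `FramePerfect`: (H4) ∧ (H2) of de Jong 1996, 3.4 Claim (ii) over the orbit
centre.** For a `G`-semi-stable pair of the line with the quasi-split rendering `hqs` of de Jong
1997, 5.7, a codimension-`2` singular point `x` of `X` and ANY blowing up `π : X₁ → X` in the
reduced ideal of the orbit closure `cl(G · x)`: (H4) at every point `x'` of `X₁` over `cl(G · x)` at
which `π ≫ f` is not smooth, the completed fibre local ring `(𝒪_{X₁,x'}/𝔪_y 𝒪_{X₁,x'})^` is
`κ(y)⟦u, v⟧/(uv)` compatibly with `κ(y)` ("the singular points of the fibres of `X' → Y` in `E`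
are rational with rational tangents", de Jong 1997, p. 618); (H2) every closed point over
`cl(G · x)` of a geometric fibre `X₁ ×_Y Spec K` of `π ≫ f` has a regular local ring of dimension
`1` or is an ordinary double point ("This scheme is smooth over `k`, except at the maximal ideal
`(u, t₁')`", de Jong 1996, p. 64). Proof: the chart of the completion at `x'` (file 6); at an
origin the quasi-split datum (file 6) and the ordinary double point of the geometric fibre
(file 7); off the origins smoothness (file 16, with the flatness of stub C1) and regularity of
dimension `1` of the geometric fibre (file 19).
[cite: DeJong1996, 3.4 Claim (ii), pp. 63–64] [cite: DeJong1997, 5.7 and proof of Prop. 5.11, pp. 614, 618] -/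
theorem stub_pair_orbitBlowupCentreLocal (k : Type) [Field k] (Y : Scheme.{0}) [IsIntegral Y]
    (q : Y ⟶ Spec (.of k)) (hprojY : Motives.IsProjectiveOver (Over.mk q))
    (hreg : Scheme.IsRegular Y) (D : Set Y)
    (hD : IsStrictNormalCrossingsDivisor Y D) (G : Type) [Group G] [Finite G] (ρY : G →* Aut Y)
    (hDG : (∀ g : G, (ρY g).hom.base '' D = D))
    (hDstrict : (∀ (g : G) (C : Set Y), Maximal (fun C : Set Y => IsIrreducible C ∧ C ⊆ D) C →
        (C ∩ (ρY g).hom.base '' C).Nonempty → (ρY g).hom.base '' C = C))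
    (X : Scheme.{0}) [IsIntegral X] (f : X ⟶ Y) (ρX : G →* Aut X)
    (hprojX : Motives.IsProjectiveOver (Over.mk (f ≫ q)))
    (hρf : ∀ g : G, (ρX g).hom ≫ f = f ≫ (ρY g).hom) (hss : IsSemiStableCurve f)
    (hqs : (∀ x : X, (¬ ∃ U : X.Opens, x ∈ U ∧ Smooth (U.ι ≫ f)) →
        ∃ e : AdicCompletion
            ((IsLocalRing.maximalIdeal (X.presheaf.stalk x)).map (Ideal.Quotient.mk
              ((IsLocalRing.maximalIdeal (Y.presheaf.stalk (f.base x))).map (f.stalkMap x).hom)))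
            (X.presheaf.stalk x ⧸
              (IsLocalRing.maximalIdeal (Y.presheaf.stalk (f.base x))).map (f.stalkMap x).hom) ≃+*
          MvPowerSeries (Fin 2) (Y.presheaf.stalk (f.base x) ⧸ IsLocalRing.maximalIdeal (Y.presheaf.stalk (f.base x))) ⧸
            Ideal.span {(MvPowerSeries.X 0 * MvPowerSeries.X 1 :
              MvPowerSeries (Fin 2) (Y.presheaf.stalk (f.base x) ⧸ IsLocalRing.maximalIdeal (Y.presheaf.stalk (f.base x))))},
          e.toRingHom.comp ((algebraMap (X.presheaf.stalk x ⧸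
              (IsLocalRing.maximalIdeal (Y.presheaf.stalk (f.base x))).map (f.stalkMap x).hom) _).comp
            (Ideal.quotientMap ((IsLocalRing.maximalIdeal (Y.presheaf.stalk (f.base x))).map (f.stalkMap x).hom)
              (f.stalkMap x).hom Ideal.le_comap_map)) =
          algebraMap (Y.presheaf.stalk (f.base x) ⧸ IsLocalRing.maximalIdeal (Y.presheaf.stalk (f.base x))) _))
    (hsm : Smooth (f ∣_ ⟨Dᶜ, hD.isClosed.isOpen_compl⟩))
    (x : X) (hx : x ∈ Scheme.singularLocusCodimLE X 2) (X₁ : Scheme.{0}) (π : X₁ ⟶ X)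
    (hπ : IsBlowup π (Scheme.IdealSheafData.vanishingIdeal
      ⟨closure (Set.range fun g : G => (ρX g).hom.base x), isClosed_closure⟩)) :
        (∀ x' : X₁, π.base x' ∈ closure (Set.range fun g : G => (ρX g).hom.base x) →
        (¬ ∃ U : X₁.Opens, x' ∈ U ∧ Smooth (U.ι ≫ (π ≫ f))) →
        ∃ e : AdicCompletion
            ((IsLocalRing.maximalIdeal (X₁.presheaf.stalk x')).map (Ideal.Quotient.mk
              ((IsLocalRing.maximalIdeal (Y.presheaf.stalk ((π ≫ f).base x'))).map ((π ≫ f).stalkMap x').hom)))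
            (X₁.presheaf.stalk x' ⧸
              (IsLocalRing.maximalIdeal (Y.presheaf.stalk ((π ≫ f).base x'))).map ((π ≫ f).stalkMap x').hom) ≃+*
          MvPowerSeries (Fin 2) (Y.presheaf.stalk ((π ≫ f).base x') ⧸ IsLocalRing.maximalIdeal (Y.presheaf.stalk ((π ≫ f).base x'))) ⧸
            Ideal.span {(MvPowerSeries.X 0 * MvPowerSeries.X 1 :
              MvPowerSeries (Fin 2) (Y.presheaf.stalk ((π ≫ f).base x') ⧸ IsLocalRing.maximalIdeal (Y.presheaf.stalk ((π ≫ f).base x'))))},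
          e.toRingHom.comp ((algebraMap (X₁.presheaf.stalk x' ⧸
              (IsLocalRing.maximalIdeal (Y.presheaf.stalk ((π ≫ f).base x'))).map ((π ≫ f).stalkMap x').hom) _).comp
            (Ideal.quotientMap ((IsLocalRing.maximalIdeal (Y.presheaf.stalk ((π ≫ f).base x'))).map ((π ≫ f).stalkMap x').hom)
              ((π ≫ f).stalkMap x').hom Ideal.le_comap_map)) =
          algebraMap (Y.presheaf.stalk ((π ≫ f).base x') ⧸ IsLocalRing.maximalIdeal (Y.presheaf.stalk ((π ≫ f).base x'))) _) ∧
    (∀ (K : Type) [Field K] [IsAlgClosed K] (s : Spec (.of K) ⟶ Y)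
      (x' : ↥(pullback (π ≫ f) s)), IsClosed ({x'} : Set ↥(pullback (π ≫ f) s)) →
      π.base ((pullback.fst (π ≫ f) s).base x') ∈
        closure (Set.range fun g : G => (ρX g).hom.base x) →
        (IsRegularLocalRing ((pullback (π ≫ f) s).presheaf.stalk x') ∧
            ringKrullDim ((pullback (π ≫ f) s).presheaf.stalk x') = 1) ∨
          IsOrdinaryDoublePoint K x') := by
  classical
  haveI : IsNoetherian X := DeJong1996.isNoetherian_of_isProjectiveOver (f ≫ q) hprojX
  haveI : IsLocallyNoetherian Y := isLocallyNoetherian_base hss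
  haveI : IsProper π := hπ.isProper
  haveI : IsProper f := hss.isProper
  haveI : IsLocallyNoetherian X₁ := LocallyOfFiniteType.isLocallyNoetherian π
  haveI : LocallyOfFiniteType (π ≫ f) := inferInstance
  haveI : LocallyOfFinitePresentation (π ≫ f) := inferInstance
  -- flatness of `π ≫ f` at the points over the centre (stub C1)
  have hflat := (stub_pair_orbitBlowupCentreFlat k Y q hprojY hreg D hD G ρY hDG hDstrict X f ρX hprojX
    hρf hss hqs hsm x hx X₁ π hπ).1
  refine ⟨fun x' hx' hns => ?_, fun K _ _ s xbar hcl hZ => ?_⟩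
  · -- (H4): the chart at `x'` (file 6); at an origin the datum, off the origin smoothness (file 16)
    obtain ⟨m, c, t, eA, j, 𝔔, h𝔔, E, ht0, h𝔔Λ, hE, hnode⟩ :=
      orbitCentreLocal_exists_chart_and_quasiSplitDatum k Y q hreg D hD G X f ρX hprojX hss hqs hsm x hx
        X₁ π hπ x' hx'
    haveI := h𝔔
    haveI : IsNoetherianRing (MvPowerSeries (Fin m) (ResidueField (Y.presheaf.stalk (f.base (π.base x'))))) :=
      isNoetherianRing_mvPowerSeries _ (Fin m)
    by_cases horig : u _ (chartParam _ c t j) ∈ 𝔔 ∧ v _ (chartParam _ c t j) ∈ 𝔔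
    · exact hnode horig.1 horig.2
    · exfalso
      apply hns
      exact exists_smooth_ι_comp_of_mem_smoothLocus (π ≫ f)
        (mem_smoothLocus_of_chart_of_not_origin (π ≫ f) x' (hflat x' hx')
          (eA.toRingHom.comp (algebraMap (Y.presheaf.stalk (f.base (π.base x')))
            (AdicCompletion (maximalIdeal (Y.presheaf.stalk (f.base (π.base x'))))
              (Y.presheaf.stalk (f.base (π.base x'))))))
          (map_maximalIdeal_cohen_comp_eq eA)
          (residuallySurjective_cohen_comp eA) 𝔔 (Localization.AtPrime 𝔔) h𝔔Λ E hE horig)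
  · -- (H2): the chart at `x' = pr₁ x̄'` (file 6); at an origin an ordinary double point (file 7),
    -- off the origin regular of dimension one (file 19)
    obtain ⟨m, c, t, eA, j, 𝔔, h𝔔, E, ht0, h𝔔Λ, hE, hnode⟩ :=
      orbitCentreLocal_exists_chart_and_quasiSplitDatum k Y q hreg D hD G X f ρX hprojX hss hqs hsm x hx
        X₁ π hπ (pullback.fst (π ≫ f) s xbar) hZ
    haveI := h𝔔
    haveI : IsNoetherianRing (MvPowerSeries (Fin m)
        (ResidueField (Y.presheaf.stalk (f.base (π.base (pullback.fst (π ≫ f) s xbar)))))) :=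
      isNoetherianRing_mvPowerSeries _ (Fin m)
    by_cases horig : u _ (chartParam _ c t j) ∈ 𝔔 ∧ v _ (chartParam _ c t j) ∈ 𝔔
    · obtain ⟨ex, hex⟩ := hnode horig.1 horig.2
      exact Or.inr (isOrdinaryDoublePoint_of_quasiSplitDatum (π ≫ f) K s xbar ex hex)
    · exact Or.inl (isRegularLocalRing_and_ringKrullDim_pullback_of_chart_of_not_origin (π ≫ f) K s xbar
        hcl (eA.toRingHom.comp (algebraMap (Y.presheaf.stalk (f.base (π.base (pullback.fst (π ≫ f) s xbar))))
          (AdicCompletion (maximalIdeal (Y.presheaf.stalk (f.base (π.base (pullback.fst (π ≫ f) s xbar)))))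
            (Y.presheaf.stalk (f.base (π.base (pullback.fst (π ≫ f) s xbar)))))))
        (map_maximalIdeal_cohen_comp_eq eA)
        (residuallySurjective_cohen_comp eA) 𝔔 (Localization.AtPrime 𝔔) h𝔔Λ E hE horig)

end Summit.ResolutionOfSingularities.ResolutionOfSingularities.Theorems

end
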